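import Literature.Analysis.Complex.CousinProblems
import Literature.Analysis.Complex.PolyhedronApprox
import HarnessLib

/-!
# `H¹ = 0` near analytic polyhedra of `ℂⁿ`: Cousin I on Stein compacta (Cartan–Oka; Hörmander §2.7)

Let `K = {z ∈ Δ̄(c₀, r) : |P_j(z)| ≤ 1}` be an analytic polyhedron of `ℂ^ι` (`analyticPolyhedron`,
`P_j` entire; closed polydiscs and, via `P = exp ∘ ℓ`, convex compacta are special cases), let
`(U_k)` be open sets covering an open neighbourhood `Ω` of `K`, and `c_{kl} ∈ 𝒪(U_k ∩ U_l)` a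
holomorphic additive `1`-cocycle. Then **`c` is a holomorphic coboundary near `K`**: there are an
open `Ω' ⊇ K` and `h_k ∈ 𝒪(U_k ∩ Ω')` with `c_{kl} = h_k − h_l` on `U_k ∩ U_l ∩ Ω'`
(`exists_holomorphic_cochain_of_cocycle_nhds_analyticPolyhedron`). This is the Čech form of
`H¹(K, 𝒪) = 0` for (germs along) Stein compacta of `ℂⁿ` (H. Cartan's Theorem B for `𝒪` in its
oldest case; Hörmander, *An Introduction to Complex Analysis in Several Variables* (1973), Thm.
2.7.6–2.7.8 with the partition-of-unity passage from Dolbeault to Čech cohomology), the additive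
companion of Cartan's lemma on holomorphic matrices.

The proof is the one of `Literature/Analysis/Complex/CousinProblems.lean` (Fritzsche–Grauert VI.2.9,
there for covers of all of `ℂ^ι` and the global `∂̄`-solver of Hörmander 2.7.8) run near `K`:
a smooth cochain `φ_k = ∑_m e_m c_{km}` for a smooth partition of unity subordinate to the cover on a
closed neighbourhood of `K` (`exists_smooth_cochain_of_cocycle_on`), the glued `∂̄`-closed
`(0,1)`-form `θ = ∂̄φ_k`, the tree's **Oka lemma**
`Literature.Analysis.Complex.exists_dbar_potential_nhds_analyticPolyhedron` (Hörmander Lemma 2.7.5 /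
Thm. 2.7.6 (a): `∂̄u = θ` near `K`), and `h_k = φ_k − u`
(`exists_holomorphic_cochain_of_smooth_nhds`).

## References

* L. Hörmander, *An Introduction to Complex Analysis in Several Variables*, 2nd ed. (1973),
  §2.7 (Thm. 2.7.6, 2.7.8) [HormanderSCV1973].
* K. Fritzsche, H. Grauert, *From Holomorphic Functions to Complex Manifolds* (2002), Ch. V §1
  Prop. 1.6, Ch. VI §2 Thm. 2.9 [FritzscheGrauert2002].
-/

noncomputable section

open scoped ContDiff Topology Manifold
open Complex Function Set Filter Metric ContinuousAlternatingMap
open Literature.LinearAlgebra.Alternating Literature.NumberTheory.Transcendental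

namespace Literature.Analysis.Complex

universe u

variable {ι : Type u} [Fintype ι] [DecidableEq ι] {κ : Type*}

/-! ### The smooth cochain on a closed set -/

omit [DecidableEq ι] in
/-- **The smooth solution of the additive Cousin problem on a closed set** (Fritzsche–Grauert,
proof of VI.2.9, localised): for open sets `U_k`, a closed set `s ⊆ ⋃ U_k` and holomorphic `c_{kl}`
on `U_k ∩ U_l` with `c_{kl} + c_{lm} = c_{km}` on triple overlaps there are `φ_k`, real-`C^∞` on
`U_k`, with `φ_k − φ_l = c_{kl}` on `U_k ∩ U_l ∩ s` (`φ_k = ∑_m e_m c_{km}` for a smooth partition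
of unity subordinate to the cover on `s`). [cite: FritzscheGrauert2002, Ch. VI §2 (proof of Thm. 2.9)] -/
theorem exists_smooth_cochain_of_cocycle_on (U : κ → Set (ι → ℂ)) (hU : ∀ k, IsOpen (U k))
    {s : Set (ι → ℂ)} (hs : IsClosed s) (hsU : s ⊆ ⋃ k, U k) (c : κ → κ → (ι → ℂ) → ℂ)
    (hc : ∀ k l, DifferentiableOn ℂ (c k l) (U k ∩ U l))
    (hcyc : ∀ k l m, ∀ x ∈ U k ∩ U l ∩ U m, c k l x + c l m x = c k m x) :
    ∃ φ : κ → (ι → ℂ) → ℂ, (∀ k, ContDiffOn ℝ ∞ (φ k) (U k)) ∧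
      ∀ k l, ∀ x ∈ U k ∩ U l ∩ s, φ k x - φ l x = c k l x := by
  have hsub : ∀ k l m, ∀ x ∈ U k ∩ U l ∩ U m, c k m x - c l m x = c k l x :=
    fun k l m x hx ↦ by linear_combination (-1 : ℂ) * hcyc k l m x hx
  obtain ⟨ρ, hρ⟩ := SmoothPartitionOfUnity.exists_isSubordinate 𝓘(ℝ, ι → ℂ) hs U hU hsU
  have hfin : ∀ x, (fun m ↦ ρ m x).HasFiniteSupport := fun x ↦
    (ρ.locallyFinite.point_finite x).subset fun _ hm ↦ hm
  refine ⟨fun k x ↦ ∑ᶠ m, ρ m x • c k m x, fun k x hx ↦ ?_, fun k l x hx ↦ ?_⟩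
  · refine ContDiffAt.contDiffWithinAt ?_
    refine ρ.contDiffAt_finsum (n := ⊤) (g := fun m ↦ c k m) fun m hm ↦ ?_
    have ho : IsOpen (U k ∩ U m) := (hU k).inter (hU m)
    exact ((SCV.contDiffOn_infty (hc k m) ho).restrict_scalars ℝ).contDiffAt
      (ho.mem_nhds ⟨hx, hρ m hm⟩)
  · show ∑ᶠ m, ρ m x • c k m x - ∑ᶠ m, ρ m x • c l m x = c k l x
    have hfk : (fun m ↦ ρ m x • c k m x).HasFiniteSupport := (hfin x).smul_left fun m ↦ c k m x
    have hfl : (fun m ↦ ρ m x • c l m x).HasFiniteSupport := (hfin x).smul_left fun m ↦ c l m x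
    rw [← finsum_sub_distrib hfk hfl]
    have h1 : ∀ m, ρ m x • c k m x - ρ m x • c l m x = ρ m x • c k l x := fun m ↦ by
      by_cases hm : ρ m x = 0
      · simp [hm]
      · have hxm : x ∈ U m := hρ m (subset_tsupport _ hm)
        rw [← smul_sub, hsub k l m x ⟨hx.1, hxm⟩]
    rw [finsum_congr h1, ← finsum_smul, ρ.sum_eq_one hx.2, one_smul]

/-! ### The `∂̄`-correction near an analytic polyhedron -/

/-- **The `∂̄`-correction near an analytic polyhedron** (Oka's lemma in place of the global
`∂̄`-solver): if the holomorphic cocycle `(c_{kl})` on open sets `U_k` covering the open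
neighbourhood `Ω` of the analytic polyhedron `K` is, on `Ω`, the coboundary of a cochain `(φ_k)` of
functions real-`C^∞` on `U_k`, then near `K` it is the coboundary of a HOLOMORPHIC cochain: the
`∂̄φ_k` glue to a `∂̄`-closed `(0,1)`-form `θ` on `Ω`, `∂̄u = θ` is solvable near `K`
(`exists_dbar_potential_nhds_analyticPolyhedron`), and `h_k = φ_k − u`.
[cite: HormanderSCV1973, Thm. 2.7.6 (a)] -/
theorem exists_holomorphic_cochain_of_smooth_nhds (m : ℕ) (c₀ : ι → ℂ) (r : ι → ℝ)
    (P : Fin m → (ι → ℂ) → ℂ) (hP : ∀ j, Differentiable ℂ (P j))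
    (U : κ → Set (ι → ℂ)) (hU : ∀ k, IsOpen (U k)) {Ω : Set (ι → ℂ)} (hΩ : IsOpen Ω)
    (hΩU : Ω ⊆ ⋃ k, U k) (hKΩ : analyticPolyhedron c₀ r P ⊆ Ω)
    (c : κ → κ → (ι → ℂ) → ℂ) (hc : ∀ k l, DifferentiableOn ℂ (c k l) (U k ∩ U l))
    (φ : κ → (ι → ℂ) → ℂ) (hφ : ∀ k, ContDiffOn ℝ ∞ (φ k) (U k))
    (hφc : ∀ k l, ∀ x ∈ U k ∩ U l ∩ Ω, φ k x - φ l x = c k l x) :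
    ∃ Ω' : Set (ι → ℂ), IsOpen Ω' ∧ analyticPolyhedron c₀ r P ⊆ Ω' ∧ Ω' ⊆ Ω ∧
      ∃ h : κ → (ι → ℂ) → ℂ, (∀ k, DifferentiableOn ℂ (h k) (U k ∩ Ω')) ∧
        ∀ k l, ∀ x ∈ U k ∩ U l ∩ Ω', h k x - h l x = c k l x := by
  classical
  -- the `0`-forms `F_k`
  set F : κ → (ι → ℂ) → (ι → ℂ) [⋀^Fin 0]→L[ℝ] ℂ := fun k ↦ zeroForm (φ k) with hF
  have hFs : ∀ k, ContDiffOn ℝ ∞ (F k) (U k) := fun k ↦ contDiffOn_zeroForm (hφ k)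
  have hFd : ∀ k, ∀ x ∈ U k, DifferentiableAt ℝ (F k) x := fun k x hx ↦
    ((hFs k).differentiableOn (by simp)).differentiableAt ((hU k).mem_nhds hx)
  -- a choice of index over `Ω`
  have hex : ∀ x ∈ Ω, ∃ k, x ∈ U k := fun x hx ↦ mem_iUnion.1 (hΩU hx)
  -- the `(0,1)`-form `θ = ∂̄φ_k` on `Ω` (and `0` off `Ω`)
  set θ : (ι → ℂ) → (ι → ℂ) [⋀^Fin (0 + 1)]→L[ℝ] ℂ := fun x ↦
    if hx : x ∈ Ω then typeProjAt 0 (0 + 1) (extDeriv (F (hex x hx).choose) x) else 0 with hθ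
  -- `θ = ∂̄φ_k` on EVERY `U_k ∩ Ω`
  have hloc : ∀ k x, x ∈ U k → x ∈ Ω → θ x = typeProjAt 0 (0 + 1) (extDeriv (F k) x) := by
    intro k x hx hxΩ
    set k' := (hex x hxΩ).choose with hk'
    have hx' : x ∈ U k' := (hex x hxΩ).choose_spec
    have hev : F k' =ᶠ[𝓝 x] fun y ↦ F k y + zeroForm (c k' k) y := by
      filter_upwards [(((hU k').inter (hU k)).inter hΩ).mem_nhds ⟨⟨hx', hx⟩, hxΩ⟩] with y hy
      simp only [hF]
      rw [← zeroForm_add_apply]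
      simp only [zeroForm]
      congr 1
      linear_combination hφc k' k y hy
    have hdc : DifferentiableAt ℂ (zeroForm (c k' k)) x :=
      differentiableAt_zeroForm
        ((hc k' k).differentiableAt (((hU k').inter (hU k)).mem_nhds ⟨hx', hx⟩))
    simp only [hθ, dif_pos hxΩ]
    rw [← hk', extDeriv_congr_of_eventuallyEq hev, extDeriv_add_apply (hFd k x hx)
      (hdc.restrictScalars ℝ), typeProjAt_add, typeProjAt_zero_one_extDeriv_eq_zero hdc, add_zero]
  -- near each point of `Ω`, `θ = (dG)^{0,1}` for a GLOBALLY smooth `0`-form `G`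
  have hθG : ∀ x₀ ∈ Ω, ∃ G : (ι → ℂ) → (ι → ℂ) [⋀^Fin 0]→L[ℝ] ℂ, ContDiff ℝ ∞ G ∧
      θ =ᶠ[𝓝 x₀] fun x ↦ typeProjAt 0 (0 + 1) (extDeriv G x) := by
    intro x₀ hx₀
    obtain ⟨k, hk⟩ := hex x₀ hx₀
    have hUo : IsOpen (U k ∩ Ω) := (hU k).inter hΩ
    obtain ⟨χ, hχs, -, hχU, O, hOo, hxO, hO1⟩ := exists_complex_cutoff_nhdsSet
      (isCompact_singleton : IsCompact ({x₀} : Set (ι → ℂ))) hUo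
      (singleton_subset_iff.2 ⟨hk, hx₀⟩)
    have hx₀O : x₀ ∈ O := hxO (mem_singleton x₀)
    refine ⟨fun x ↦ χ x • F k x,
      contDiff_smul_of_tsupport_subset hUo hχs hχU ((hFs k).mono inter_subset_left), ?_⟩
    filter_upwards [hOo.mem_nhds hx₀O, hUo.mem_nhds ⟨hk, hx₀⟩] with x hxO' hxU
    have hev : F k =ᶠ[𝓝 x] fun y ↦ χ y • F k y := by
      filter_upwards [hOo.mem_nhds hxO'] with y hy
      rw [hO1 y hy, one_smul]
    rw [hloc k x hxU.1 hxU.2, extDeriv_congr_of_eventuallyEq hev]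
  have hθs : ContDiffOn ℝ ∞ θ Ω := fun x₀ hx₀ ↦ by
    obtain ⟨G, hG, hθG'⟩ := hθG x₀ hx₀
    exact ((contDiff_typeProjAt_extDeriv 0 (0 + 1) hG).contDiffAt.congr_of_eventuallyEq
      hθG').contDiffWithinAt
  have hθt : ∀ x ∈ Ω, IsOfTypeAt 0 (0 + 1) (θ x) := fun x hx ↦ by
    simp only [hθ, dif_pos hx]
    exact isOfTypeAt_typeProjAt rfl _
  have hθc : ∀ x ∈ Ω, typeProjAt 0 (0 + 2) (extDeriv θ x) = 0 := fun x₀ hx₀ ↦ by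
    obtain ⟨G, hG, hθG'⟩ := hθG x₀ hx₀
    rw [extDeriv_congr_of_eventuallyEq hθG']
    exact dbar_dbar_eq_zero (p := 0) (q := 0) (fun y ↦ isOfTypeAt_zero_zero (G y)) hG x₀
  -- Oka's lemma: solve `∂̄u = θ` near `K`
  obtain ⟨Ω', hΩ'o, hKΩ', hΩ'Ω, u, hus, -, huθ⟩ :=
    exists_dbar_potential_nhds_analyticPolyhedron m c₀ r P hP (n := 0) (p := 0) (q := 0) hΩ hKΩ
      hθs hθt hθc
  have hud : ∀ x ∈ Ω', DifferentiableAt ℝ u x := fun x hx ↦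
    (hus.differentiableOn (by simp)).differentiableAt (hΩ'o.mem_nhds hx)
  -- `h_k = φ_k - u()` is holomorphic on `U_k ∩ Ω'`
  refine ⟨Ω', hΩ'o, hKΩ', hΩ'Ω, fun k x ↦ φ k x - evalZeroForm (u x), fun k ↦ ?_,
    fun k l x hx ↦ by rw [← hφc k l x ⟨hx.1, hΩ'Ω hx.2⟩]; ring⟩
  have hδ : DifferentiableOn ℂ (fun x ↦ evalZeroForm (F k x - u x)) (U k ∩ Ω') := by
    refine differentiableOn_evalZeroForm_of_dbar_eq_zero (F := fun x ↦ F k x - u x)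
      ((hU k).inter hΩ'o)
      (fun x hx ↦ ((hFd k x hx.1).sub (hud x hx.2)).differentiableWithinAt) fun x hx ↦ ?_
    rw [extDeriv_sub_apply (hFd k x hx.1) (hud x hx.2), typeProjAt_sub,
      ← hloc k x hx.1 (hΩ'Ω hx.2), huθ x hx.2, sub_self]
  refine hδ.congr fun x _ ↦ ?_
  simp [hF]

/-! ### `H¹(K, 𝒪) = 0` -/

/-- **Cousin I near analytic polyhedra: `H¹(K, 𝒪) = 0` in Čech form** (Cartan–Oka; Hörmander
§2.7). Let `K ⊆ ℂ^ι` be an analytic polyhedron, `(U_k)` open sets covering an open `Ω ⊇ K`, and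
`c_{kl}` holomorphic on `U_k ∩ U_l` with `c_{kl} + c_{lm} = c_{km}` on `U_k ∩ U_l ∩ U_m`. Then there
are an open `Ω'` with `K ⊆ Ω' ⊆ Ω` and holomorphic `h_k` on `U_k ∩ Ω'` with `c_{kl} = h_k − h_l` on
`U_k ∩ U_l ∩ Ω'`. [cite: HormanderSCV1973, Thm. 2.7.6–2.7.8 (with the Dolbeault–Čech passage)] -/
theorem exists_holomorphic_cochain_of_cocycle_nhds_analyticPolyhedron (m : ℕ) (c₀ : ι → ℂ)
    (r : ι → ℝ) (P : Fin m → (ι → ℂ) → ℂ) (hP : ∀ j, Differentiable ℂ (P j))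
    (U : κ → Set (ι → ℂ)) (hU : ∀ k, IsOpen (U k)) {Ω : Set (ι → ℂ)} (hΩ : IsOpen Ω)
    (hΩU : Ω ⊆ ⋃ k, U k) (hKΩ : analyticPolyhedron c₀ r P ⊆ Ω)
    (c : κ → κ → (ι → ℂ) → ℂ) (hc : ∀ k l, DifferentiableOn ℂ (c k l) (U k ∩ U l))
    (hcyc : ∀ k l m, ∀ x ∈ U k ∩ U l ∩ U m, c k l x + c l m x = c k m x) :
    ∃ Ω' : Set (ι → ℂ), IsOpen Ω' ∧ analyticPolyhedron c₀ r P ⊆ Ω' ∧ Ω' ⊆ Ω ∧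
      ∃ h : κ → (ι → ℂ) → ℂ, (∀ k, DifferentiableOn ℂ (h k) (U k ∩ Ω')) ∧
        ∀ k l, ∀ x ∈ U k ∩ U l ∩ Ω', c k l x = h k x - h l x := by
  -- a closed neighbourhood `s` of `K` inside `Ω`, and an open `Ω₁` in between
  obtain ⟨δ, hδ, hδΩ⟩ := (isCompact_analyticPolyhedron c₀ r fun j ↦ (hP j).continuous).exists_cthickening_subset_open
    hΩ hKΩ
  set Ω₁ : Set (ι → ℂ) := thickening δ (analyticPolyhedron c₀ r P) with hΩ₁
  have hΩ₁o : IsOpen Ω₁ := isOpen_thickening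
  have hKΩ₁ : analyticPolyhedron c₀ r P ⊆ Ω₁ := self_subset_thickening hδ _
  have hΩ₁s : Ω₁ ⊆ cthickening δ (analyticPolyhedron c₀ r P) := thickening_subset_cthickening δ _
  have hΩ₁Ω : Ω₁ ⊆ Ω := hΩ₁s.trans hδΩ
  -- smooth cochain on `s`
  obtain ⟨φ, hφ, hφc⟩ := exists_smooth_cochain_of_cocycle_on U hU isClosed_cthickening
    (hδΩ.trans hΩU) c hc hcyc
  -- holomorphic correction near `K`
  obtain ⟨Ω', hΩ'o, hKΩ', hΩ'Ω₁, h, hh, hhc⟩ := exists_holomorphic_cochain_of_smooth_nhds m c₀ r P hP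
    U hU hΩ₁o (hΩ₁Ω.trans hΩU) hKΩ₁ c hc φ hφ
    (fun k l x hx ↦ hφc k l x ⟨hx.1, hΩ₁s hx.2⟩)
  exact ⟨Ω', hΩ'o, hKΩ', hΩ'Ω₁.trans hΩ₁Ω, h, hh, fun k l x hx ↦ (hhc k l x hx).symm⟩

/-! ### Vector-valued cocycles -/

/-- **`H¹(K, 𝒪^N) = 0` near analytic polyhedra**: the same for cocycles with values in `ℂ^N`
(componentwise, intersecting the finitely many neighbourhoods; for `N = 0` take `Ω' = Ω`).
[cite: HormanderSCV1973, Thm. 2.7.6–2.7.8 (with the Dolbeault–Čech passage)] -/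
theorem exists_holomorphic_cochain_of_cocycle_nhds_analyticPolyhedron_pi {N : ℕ} (m : ℕ)
    (c₀ : ι → ℂ) (r : ι → ℝ) (P : Fin m → (ι → ℂ) → ℂ) (hP : ∀ j, Differentiable ℂ (P j))
    (U : κ → Set (ι → ℂ)) (hU : ∀ k, IsOpen (U k)) {Ω : Set (ι → ℂ)} (hΩ : IsOpen Ω)
    (hΩU : Ω ⊆ ⋃ k, U k) (hKΩ : analyticPolyhedron c₀ r P ⊆ Ω)
    (c : κ → κ → (ι → ℂ) → (Fin N → ℂ)) (hc : ∀ k l, DifferentiableOn ℂ (c k l) (U k ∩ U l))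
    (hcyc : ∀ k l m, ∀ x ∈ U k ∩ U l ∩ U m, c k l x + c l m x = c k m x) :
    ∃ Ω' : Set (ι → ℂ), IsOpen Ω' ∧ analyticPolyhedron c₀ r P ⊆ Ω' ∧ Ω' ⊆ Ω ∧
      ∃ h : κ → (ι → ℂ) → (Fin N → ℂ), (∀ k, DifferentiableOn ℂ (h k) (U k ∩ Ω')) ∧
        ∀ k l, ∀ x ∈ U k ∩ U l ∩ Ω', c k l x = h k x - h l x := by
  -- componentwise solutions
  have hcomp : ∀ a : Fin N, ∃ Ω' : Set (ι → ℂ), IsOpen Ω' ∧ analyticPolyhedron c₀ r P ⊆ Ω' ∧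
      Ω' ⊆ Ω ∧ ∃ h : κ → (ι → ℂ) → ℂ, (∀ k, DifferentiableOn ℂ (h k) (U k ∩ Ω')) ∧
        ∀ k l, ∀ x ∈ U k ∩ U l ∩ Ω', c k l x a = h k x - h l x := fun a ↦
    exists_holomorphic_cochain_of_cocycle_nhds_analyticPolyhedron m c₀ r P hP U hU hΩ hΩU hKΩ
      (fun k l x ↦ c k l x a) (fun k l ↦ differentiableOn_pi.1 (hc k l) a)
      (fun k l m' x hx ↦ by simpa using congrFun (hcyc k l m' x hx) a)
  choose Ω' hΩ'o hKΩ' hΩ'Ω h hh hhc using hcomp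
  -- intersect (with `Ω` itself, to cover `N = 0`)
  refine ⟨Ω ∩ ⋂ a, Ω' a, hΩ.inter (isOpen_iInter_of_finite hΩ'o), subset_inter hKΩ (subset_iInter hKΩ'),
    inter_subset_left, fun k x a ↦ h a k x, fun k ↦ ?_, fun k l x hx ↦ ?_⟩
  · refine differentiableOn_pi.2 fun a ↦ (hh a k).mono ?_
    exact inter_subset_inter_right _ (inter_subset_right.trans (iInter_subset _ a))
  · funext a
    exact hhc a k l x ⟨hx.1, mem_iInter.1 hx.2.2 a⟩

end Literature.Analysis.Complex
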